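import Summits.BirchSwinnertonDyer.Rank1Residual.X11a.VisibilityRecordsNoRam
import Summits.BirchSwinnertonDyer.Rank1Residual.Supersingular.DescentLowerBound
import Summits.BirchSwinnertonDyer.Rank1Residual.X11b.MultiplicativeSurjectivity
import Summits.BirchSwinnertonDyer.Rank1Residual.GaloisImage.FrobeniusOrderWitness
import Summits.BirchSwinnertonDyer.BirchSwinnertonDyer.Theorems.Rank1ResidualIntModelReduction
import Summits.BirchSwinnertonDyer.BirchSwinnertonDyer.Theorems.Rank1ResidualX11RankOneReduction
import Literature.NumberTheory.EllipticCurves.Rank1Residual.Typed.WuthrichUpperBound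
import Literature.NumberTheory.EllipticCurves.Rank1Residual.PrintShape
import HarnessLib

/-!
# Route `PrintX11a` (cell `bsd-print-x11a`, seat p2), crux L `X11aLowerHalf` (item stmt-BirchSwinnertonDyer-19064)
# PER PAIR at `p = 3`: the 3-DESCENT DOOR — `BSD(E,3)` on `ClassX11a ∧ Surj(3) ∧ ord₃ #Ш_an ≤ 2` from
# Wuthrich 2014 Prop. 21 (upper half) and Cassels–Tate + ONE native certificate line `Sel^(3)(E/ℚ) ≠ 0`
# (lower half), with the class atoms assembled in the kernel from a literal integer model
# (`--supports stmt-BirchSwinnertonDyer-19064`; consumed by `PrintX11aThreeDescentRecords*.lean`)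

HONEST FRAMING. Theorems only; no definition, no named fact, no `sorry`. PER PAIR (E1 currency): nothing here
closes crux L `X11aLowerHalf` (`∀` X11a pairs), which stays OPEN class-wide (Skinner–Urban without (ram) at
`p ∥ N`; barrier B3); the leaf `ClassX11a` stays open; BSD is not proved by any of this. beyond-print theorem: NO
— every step is a published theorem BY NAME or kernel arithmetic; the only non-kernel datum per pair is the
finite `3`-descent certificate `Sel^(3)(E/ℚ) ≠ 0` (and Cremona's `r_an = 0`, `#Ш_an`).

## What

At a pair `(E, 3)` of class X11a (`r_an = 0`, `3 ∥ N`, `E[3]` irreducible, no (ram) prime) whose mod-`3`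
representation is SURJECTIVE and whose analytic order of `Ш` has `ord₃ ≤ 2`, both Miller halves are in the
tree BY NAME, flag-free:
* UPPER `ord₃ #Ш ≤ ord₃ #Ш_an`: Wuthrich, Doc. Math. 19 (2014) Prop. 21 (`Wuthrich2014.sha_dvd_analyticSha`;
  the constant `C` is supported at `2`, additive primes and primes of exotic image — `3` is multiplicative and
  the image is `GL₂(𝔽₃)`; `3`-adic surjectivity inside the printed proof is Lemma 20 at `9 ∤ N`, PROVED in
  the tree) — `Typed.missingUpperBoundAt_of_wuthrich` / `Typed.bsdp_of_missingLowerBoundAt_of_wuthrich`;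
* LOWER `ord₃ #Ш_an ≤ ord₃ #Ш`: `Sel^(3)(E/ℚ) ≠ 0`, rank `0` (GZK) and `3 ∤ #E(ℚ)_tors` (irreducibility,
  `padicValNat_torsionOrder_eq_zero_of_irreducible`) give `Ш(E/ℚ)[3] ≠ 0` by the PROVED fundamental
  sequence (`exists_sha_torsion_of_selmerGroup_ne_bot`), hence `3 ∣ #Ш`, hence `9 ∣ #Ш` by Cassels–Tate
  squareness (`exists_casselsTate_pairing`) — `Supersingular.missingLowerBoundAt_of_casselsTate_of_selmerGroup_ne_bot`
  (unit x6's class-free door; its X6 twin is `X6.bsdp_rankZero_of_casselsTate_of_selmerGroup_ne_bot`).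
This file packages the composition ONCE:
* `mlb_of_classX11a_of_selmerGroup_ne_bot` ⇒ `Typed.MissingLowerBoundAt W p` (crux-L currency; any prime `p`);
* `bsdp_of_classX11a_of_surj_of_selmerGroup_ne_bot` ⇒ `BSDp W p` (odd `p`, surjective image);
* `classX11a_of_ainvs_of_primeList` — the class ASSEMBLED IN THE KERNEL from decidable integer data of a
  literal model `[a₁,…,a₆]`: `p ∣ Δ`, `p ∤ c₄` (`Mult`, Silverman VII.5.1 (b)); ONE Frobenius witness `ℓ`
  (kernel point count `#Ẽ(𝔽_ℓ) = n`, `X² − (ℓ+1−n)X + ℓ` root-free mod `p`: `Irr`, Mazur 1978 Prop. 6.3 (1));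
  the complete prime support of `Δ` with every prime `= p`, additive (`ℓ ∣ c₄`) or with `p ∣ ord_ℓ Δ`
  (`¬ Ram`, p4's `not_ram_of_intModel`) — leaving DISPLAYED only `r_an = 0` (the grammar of p4's
  `X11a/VisibilityRecordsAtoms*.lean`, packaged);
* `surj_of_classX11a_of_intModel_of_not_dvd` — the image bit in the kernel at a très ramifié pair (`p ∤ ord_p Δ`,
  x11c's `ClassX11a.surj_of_not_dvd`); at a peu ramifié pair the records call the two-witness decider
  `GaloisImage.hasSurjectiveModNGaloisRep_of_intModel_of_irr_of_order` directly;
* `bsdp_of_ainvs_of_selmerGroup_ne_bot` — everything at once over the literal model.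
Census served (records files): the 393 surjective X11a cells at `p = 3` with `#Ш_an = 9`, `2·10⁴ ≤ N < 5·10⁵`, of
the sister lane's census v12 (b2b-bsdres-x11a gen 34/35), each with `dim_𝔽₃ Sel^(3)(E/ℚ) = 2` EXACT on TWO
independent engines (x11b `desc3lib.gp` kit j156364; x10b `desc3full_e2.py` kit j156365) — written up there as
"LOWER HALF only"; the upper half is Wuthrich's by name, so `BSD(E,3)` is bookable per pair.

References: [Wuthrich2014] Prop. 21 (p. 400), Lemma 20 (p. 399); [SilvermanAEC2009] Thm. X.4.2 (a), X.4.14,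
VII.5.1; [Mazur1978] Prop. 6.3 (1); [Serre1972] §2.4 Prop. 15, §2.8 Prop. 19; [SilvermanATAEC1994] V.6.1;
[Miller2011LMS] Def. 1.1; cell files `X11a/VisibilityRecordsAtoms1.lean` (p4, grammar), `X11a/VisibilityRecordsNoRam.lean`
(p4, tool), `Supersingular/DescentLowerBound.lean` (x6, door), HOME/PLAN.md v6.3 Q8, HOME/P2-TRANSPORT-ROAD.md.
-/

set_option linter.dupNamespace false -- the directory name repeats the summit name (sibling precedent)

set_option autoImplicit false

noncomputable section

open scoped Classical

open WeierstrassCurve Literature.NumberTheory.EllipticCurves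
  Literature.NumberTheory.EllipticCurves.Rank1Residual
  Literature.NumberTheory.EllipticCurves.Rank1Residual.Typed
  Literature.NumberTheory.EllipticCurves.Rank1Residual.X11RankOneCertificates
  Literature.NumberTheory.EllipticCurves.Wuthrich2014
  Summit.BirchSwinnertonDyer.BirchSwinnertonDyer.Rank1Residual.IntModel
  Summit.BirchSwinnertonDyer.BirchSwinnertonDyer.Rank1Residual.X11RankOne
  Summit.BirchSwinnertonDyer.Rank1Residual
  Summit.BirchSwinnertonDyer.Rank1Residual.X11a.VisibilityRecords

namespace Summit.BirchSwinnertonDyer.BirchSwinnertonDyer.Theorems.ThreeDescentRecords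

variable {W : WeierstrassCurve ℚ} [W.IsElliptic] [W.IsGloballyMinimal]

/-! ### §1. The two halves on the class, from the certificate line `Sel^(p)(E/ℚ) ≠ 0` -/

/-- **Crux-L currency on X11a from ONE native descent line.** `ClassX11a W p` (so `r_an = 0` and `E[p]`
irreducible), `#Ш_an = q` with `ord_p q ≤ 2`, and `Sel^(p)(E/ℚ) ≠ 0` ⇒ `Typed.MissingLowerBoundAt W p`:
irreducibility kills the rational `p`-torsion (`padicValNat_torsionOrder_eq_zero_of_irreducible`), so with rank `0`
(GZK `hGZK`) the Selmer group is `Ш[p] ≠ 0`, `p ∣ #Ш`, and Cassels–Tate squareness (`hCT`) gives `p² ∣ #Ш`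
(x6's class-free `Supersingular.missingLowerBoundAt_of_casselsTate_of_selmerGroup_ne_bot`). Per pair; not a class
theorem. [cite: SilvermanAEC2009, Thm. X.4.2 (a) and X.4.14] [cite: Miller2011LMS, §1 and Def. 1.1] -/
theorem mlb_of_classX11a_of_selmerGroup_ne_bot (hCT : exists_casselsTate_pairing (K := ℚ))
    (hGZK : rank_eq_analyticRank_of_analyticRank_le_one) (p : ℕ) [Fact p.Prime] (hX : ClassX11a W p)
    {q : ℚ} (hq : shaAn W = (q : ℂ)) (hv : padicValRat p q ≤ 2) (hSel : W.selmerGroup (p : ℤ) ≠ ⊥) :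
    MissingLowerBoundAt W p := by
  have htors : ¬ p ∣ W.torsionOrder := by
    have h0 := padicValNat_torsionOrder_eq_zero_of_irreducible W p hX.irr
    rw [padicValNat.eq_zero_iff] at h0
    rcases h0 with h | h | h
    · exact absurd h (Fact.out : p.Prime).one_lt.ne'
    · exact absurd h (torsionOrder_pos_holds (W := W)).ne'
    · exact h
  exact Supersingular.missingLowerBoundAt_of_casselsTate_of_selmerGroup_ne_bot W p hCT hGZK hX.1 htors hq hv
    hSel

/-- **`BSD(E,p)` on X11a with surjective image from ONE native descent line.** `ClassX11a W p` (odd multiplicative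
`p`, `r_an = 0`, irreducible), `ρ̄_{E,p}` onto, `#Ш_an = q` with `ord_p q ≤ 2`, `Sel^(p)(E/ℚ) ≠ 0` ⇒ `BSDp W p`:
the lower half is `mlb_of_classX11a_of_selmerGroup_ne_bot`; the upper half is Wuthrich 2014 Prop. 21 (`hW`; a
multiplicative prime is not additive, `HasMultiplicativeReduction.not_hasAdditiveReduction`; image surjective), with
GZK (`hGZK`) and modularity (`hmod`) — `Typed.bsdp_of_missingLowerBoundAt_of_wuthrich`. Per pair; not a class theorem.
[cite: Wuthrich2014, Prop. 21 (p. 400)] [cite: SilvermanAEC2009, Thm. X.4.14] [cite: Miller2011LMS, §1 and Def. 1.1] -/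
theorem bsdp_of_classX11a_of_surj_of_selmerGroup_ne_bot (hCT : exists_casselsTate_pairing (K := ℚ))
    (hW : sha_dvd_analyticSha) (hGZK : rank_eq_analyticRank_of_analyticRank_le_one)
    (hmod : hasEntireLFunction_rat) (p : ℕ) [Fact p.Prime] (hX : ClassX11a W p) (hsurj : Surj W p)
    {q : ℚ} (hq : shaAn W = (q : ℂ)) (hv : padicValRat p q ≤ 2) (hSel : W.selmerGroup (p : ℤ) ≠ ⊥) :
    BSDp W p :=
  bsdp_of_missingLowerBoundAt_of_wuthrich W p hW hGZK hmod hX.ne_two hX.1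
    (WeierstrassCurve.HasMultiplicativeReduction.not_hasAdditiveReduction (R := ℤ_[p]) hX.mult)
    (Or.inr hsurj) (mlb_of_classX11a_of_selmerGroup_ne_bot hCT hGZK p hX hq hv hSel)

/-! ### §2. The class atoms and the image bit from a literal integer model (kernel) -/

/-- **`ClassX11a W p` assembled in the KERNEL from a literal integer model, up to `r_an = 0`** (p4's grammar of
`X11a/VisibilityRecordsAtoms*.lean`, packaged once): `p ∥ N` from `p ∣ Δ`, `p ∤ c₄` (Silverman VII.5.1 (b), tree
`hasMultiplicativeReductionAtPrime_of_intModel`); `E[p]` irreducible by ONE Frobenius witness — a good prime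
`ℓ ≠ p` with kernel point count `#Ẽ(𝔽_ℓ) = n` and `X² − (ℓ + 1 − n)X + ℓ` root-free mod `p` (Mazur 1978
Prop. 6.3 (1), tree `hasIrreducibleModPGaloisRep_of_intModel_of_noroot`); NO (ram) prime by the complete prime
support `L` of `Δ` (`|Δ| = ∏ qᵢ^{eᵢ}`), every member being `p`, additive (`ℓ ∣ c₄`) or with `p ∣ ord_ℓ Δ`
(`not_ram_of_intModel`). [cite: SilvermanAEC2009, VII.5 Prop. 5.1] [cite: Mazur1978, §6 Prop. 6.3 (1) (p. 153)]
[cite: SkinnerUrban2014, Thm. 2 (p. 3), second bullet] -/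
theorem classX11a_of_ainvs_of_primeList
    (a1 a2 a3 a4 a6 : ℤ) (hI : integralModelInt W = ⟨a1, a2, a3, a4, a6⟩) (p ℓ n : ℕ) [Fact p.Prime]
    [Fact ℓ.Prime] (hp2 : p ≠ 2) (hpΔ : (p : ℤ) ∣ discOf [a1, a2, a3, a4, a6])
    (hpc4 : ¬ (p : ℤ) ∣ c4Of [a1, a2, a3, a4, a6]) (hℓp : ℓ ≠ p) (hℓΔ : ¬ (ℓ : ℤ) ∣ discOf [a1, a2, a3, a4, a6])
    (hcard : Nat.card (((⟨a1, a2, a3, a4, a6⟩ : WeierstrassCurve ℤ).map (Int.castRingHom (ZMod ℓ))).toAffine.Point) = n)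
    (hnoroot : ∀ t : ℕ, t < p → ¬ (p : ℤ) ∣ (t : ℤ) ^ 2 - ((ℓ : ℤ) + 1 - n) * t + ℓ)
    (L es : List ℕ) (hL : ∀ q ∈ L, q.Prime)
    (hfac : (discOf [a1, a2, a3, a4, a6]).natAbs = ((L.zip es).map fun qe : ℕ × ℕ ↦ qe.1 ^ qe.2).prod)
    (hall : ∀ q ∈ L, q = p ∨ (q : ℤ) ∣ c4Of [a1, a2, a3, a4, a6] ∨ (p : ℤ) ∣ padicValInt q (discOf [a1, a2, a3, a4, a6]))
    (hr : W.analyticRank = 0) : ClassX11a W p := by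
  haveI : NeZero p := ⟨(Fact.out : p.Prime).ne_zero⟩
  have hΔ : (⟨a1, a2, a3, a4, a6⟩ : WeierstrassCurve ℤ).Δ = discOf [a1, a2, a3, a4, a6] := intCurve_Δ a1 a2 a3 a4 a6
  have hc4 : (⟨a1, a2, a3, a4, a6⟩ : WeierstrassCurve ℤ).c₄ = c4Of [a1, a2, a3, a4, a6] := intCurve_c₄ a1 a2 a3 a4 a6
  have hmult : Mult W p :=
    hasMultiplicativeReductionAtPrime_of_intModel hI p (by rw [hΔ]; exact hpΔ) (by rw [hc4]; exact hpc4)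
  have hirr : Irr W p := by
    refine hasIrreducibleModPGaloisRep_of_intModel_of_noroot hI p ℓ hℓp (by rw [hΔ]; exact hℓΔ) hcard
      (forall_zmod_of_forall_lt fun t ht h0 ↦ hnoroot t ht ?_)
    rw [← ZMod.intCast_zmod_eq_zero_iff_dvd]
    push_cast at h0 ⊢
    linear_combination h0
  have hnram : ¬ Ram W p := not_ram_of_intModel hI p L es hL (by rw [hΔ]; exact hfac)
    (by rw [hΔ, hc4]; exact hall)
  exact ⟨hr, hp2, hmult, hirr, hnram⟩

/-- **The image bit in the kernel at a très ramifié pair**: on `ClassX11a W p`, `p ∤ ord_p Δ_min` forces `ρ̄_{E,p}`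
onto (x11c's `ClassX11a.surj_of_not_dvd`: irreducible + a transvection from the Tate curve); the valuation is read
off the literal model (`p^e ∥ Δ`). [cite: SilvermanATAEC1994, V.6 Prop. 6.1 (p. 410)] [cite: Serre1972, §2.8 Prop. 19] -/
theorem surj_of_classX11a_of_intModel_of_not_dvd
    (a1 a2 a3 a4 a6 : ℤ) (hI : integralModelInt W = ⟨a1, a2, a3, a4, a6⟩) (p : ℕ) [Fact p.Prime]
    (hX : ClassX11a W p) (e : ℕ) (he : (p : ℤ) ^ e ∣ discOf [a1, a2, a3, a4, a6])
    (he' : ¬ (p : ℤ) ^ (e + 1) ∣ discOf [a1, a2, a3, a4, a6]) (hpe : ¬ p ∣ e) : Surj W p := by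
  refine ClassX11a.surj_of_not_dvd W p hX ?_
  have hΔ : (⟨a1, a2, a3, a4, a6⟩ : WeierstrassCurve ℤ).Δ = discOf [a1, a2, a3, a4, a6] := intCurve_Δ a1 a2 a3 a4 a6
  rw [minimalDiscriminantInt_eq hI, hΔ, padicValInt_eq_of_dvd_of_not_dvd p he he']
  exact_mod_cast hpe

/-! ### §3. Everything at once over the literal model -/

/-- **RECORD SHAPE of the 3-descent door over a literal integer model.** For a globally minimal `W = [a₁,…,a₆]`: the
class atoms in the kernel (`classX11a_of_ainvs_of_primeList`: `hpΔ`/`hpc4`, Frobenius witness `ℓ`, `n`, prime list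
`L`, `es`), the image bit `hsurj` (kernel, supplied by the record), and DISPLAYED `hr` (`r_an = 0`), `hq`/`hv`
(`#Ш_an = q`, `ord_p q ≤ 2`), `hSel` (`Sel^(p)(E/ℚ) ≠ 0`, the finite descent certificate) ⇒ `BSDp W p`, modulo the
four published facts `hCT` (Cassels–Tate), `hW` (Wuthrich Prop. 21), `hGZK`, `hmod`. Per pair; nothing class-wide.
[cite: Wuthrich2014, Prop. 21 (p. 400)] [cite: SilvermanAEC2009, Thm. X.4.2 (a) and X.4.14]
[cite: Miller2011LMS, §1 and Def. 1.1] -/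
theorem bsdp_of_ainvs_of_selmerGroup_ne_bot (hCT : exists_casselsTate_pairing (K := ℚ))
    (hW : sha_dvd_analyticSha) (hGZK : rank_eq_analyticRank_of_analyticRank_le_one)
    (hmod : hasEntireLFunction_rat)
    (a1 a2 a3 a4 a6 : ℤ) (hI : integralModelInt W = ⟨a1, a2, a3, a4, a6⟩) (p ℓ n : ℕ) [Fact p.Prime]
    [Fact ℓ.Prime] (hp2 : p ≠ 2) (hpΔ : (p : ℤ) ∣ discOf [a1, a2, a3, a4, a6])
    (hpc4 : ¬ (p : ℤ) ∣ c4Of [a1, a2, a3, a4, a6]) (hℓp : ℓ ≠ p) (hℓΔ : ¬ (ℓ : ℤ) ∣ discOf [a1, a2, a3, a4, a6])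
    (hcard : Nat.card (((⟨a1, a2, a3, a4, a6⟩ : WeierstrassCurve ℤ).map (Int.castRingHom (ZMod ℓ))).toAffine.Point) = n)
    (hnoroot : ∀ t : ℕ, t < p → ¬ (p : ℤ) ∣ (t : ℤ) ^ 2 - ((ℓ : ℤ) + 1 - n) * t + ℓ)
    (L es : List ℕ) (hL : ∀ q ∈ L, q.Prime)
    (hfac : (discOf [a1, a2, a3, a4, a6]).natAbs = ((L.zip es).map fun qe : ℕ × ℕ ↦ qe.1 ^ qe.2).prod)
    (hall : ∀ q ∈ L, q = p ∨ (q : ℤ) ∣ c4Of [a1, a2, a3, a4, a6] ∨ (p : ℤ) ∣ padicValInt q (discOf [a1, a2, a3, a4, a6]))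
    (hr : W.analyticRank = 0) (hsurj : ClassX11a W p → Surj W p)
    {q : ℚ} (hq : shaAn W = (q : ℂ)) (hv : padicValRat p q ≤ 2) (hSel : W.selmerGroup (p : ℤ) ≠ ⊥) :
    BSDp W p :=
  have hX : ClassX11a W p := classX11a_of_ainvs_of_primeList a1 a2 a3 a4 a6 hI p ℓ n hp2 hpΔ hpc4 hℓp hℓΔ
    hcard hnoroot L es hL hfac hall hr
  bsdp_of_classX11a_of_surj_of_selmerGroup_ne_bot hCT hW hGZK hmod p hX (hsurj hX) hq hv hSel

end Summit.BirchSwinnertonDyer.BirchSwinnertonDyer.Theorems.ThreeDescentRecords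

end
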